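import Mathlib.Analysis.Complex.BorelCaratheodory
import Mathlib.Analysis.Complex.HasPrimitives
import Literature.Analysis.Complex.CauchyTaylorBall
import Literature.Probability.LatticeModels.SpinWaveComplexStabilityTorus
import Summits.HubbardSuperconductivity.HubbardSuperconductivity.Theorems.NodalWardXYPerturbedXYOrderReduction

/-!
# `PerturbedXYOrder` (stmt-HubbardSuperconductivity-10739) — the crux is EQUIVALENT to the Gevrey-1 cumulant bounds

Crux (route `NodalWardXY`, rank 3): `Summit.HubbardSuperconductivity.HubbardSuperconductivity.Theses.NodalWardXY.PerturbedXYOrder`.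

`Theorems/NodalWardXYPerturbedXYOrderReduction.lean` (line `schwarz-inheritance`) proves
`perturbedXYOrder_of_cumulantBounds`: uniform Gevrey-1 bounds on the Taylor coefficients at `t = 0` of
`t ↦ log(Z(tK)/Z(0))` (`≤ n! Aⁿ L³`) and of `t ↦ cratio L J (t • K)` (`≤ n! Aⁿ`) for all kernels admissible at some radius
imply the crux. This file proves the CONVERSE, `cumulantBounds_of_perturbedXYOrder`, and records
`perturbedXYOrder_iff_cumulantBounds`. So the second registered packaging of the open stub (`stub_cumulantBounds`, "cumulants of
`W_K` and mixed cumulants with the order observable under the REAL Gibbs state") is also exactly the crux.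

Proof (classical; drefute note `Cruxes/PerturbedXYOrder/DrefuteSchwarzInheritance.md` §3): given the crux with `(J₀, ε, a)` take
radius `ε/2`; along the ray `‖t‖ < 2` the kernel `t • K` is admissible at radius `ε`, so `Z(tK) ≠ 0` and `Re cratio(tK) ≥ a`.
* Free-energy half: `Z(t•K)` is entire (`stub_entire`) and zero-free on the disc `‖t‖ < 2`, so `Z'/Z` has a primitive `G` there
  (`DifferentiableOn.isExactOn_ball`, Mathlib), `G(0) = 0`, and `Z(tK) = Z(0) e^{G(t)}` (`Z e^{-G}` has zero derivative on the disc).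
  The deterministic sup bound `‖W_K‖ ≤ 432 (ε/2) L³` (`ent_norm_Wk_le` + the uniform lattice sum `row_sum_norm_le_of_admissible`)
  gives `Re G(t) = log ‖Z(tK)/Z(0)‖ ≤ ‖t‖ sup‖W_K‖`, Borel–Carathéodory (`Complex.borelCaratheodory_zero`) bounds `‖G‖ ≤ 6M` on
  `‖t‖ < 3/2`, Cauchy's estimate bounds `G⁽ⁿ⁾(0)`, and `G` agrees with the principal `log(Z(tK)/Z(0))` near `t = 0`.
* Plateau half: `‖cratio(tK)‖ ≤ 5` on `‖t‖ < 1` (Borel–Carathéodory for `-cratio`, as in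
  `Theorems/NodalWardXYPerturbedXYOrderEquivalence.lean`, whose `perturbedXYOrder_iff_complexStability` is the first packaging)
  and Cauchy's estimate.
-/

noncomputable section

-- `<Problem> = <Summit>` doubles the path component (project-wide `weak.linter.dupNamespace = false` in the lakefile;
-- repeated here so that single-file elaboration is warning-free too).
set_option linter.dupNamespace false

namespace Summit.HubbardSuperconductivity.HubbardSuperconductivity.Theorems.PerturbedXYOrder

open MeasureTheory Metric Set Filter Topology Literature.Probability.LatticeModels
open scoped Nat
open Summit.HubbardSuperconductivity.HubbardSuperconductivity.Theses.NodalWardXY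

variable {L : ℕ}

/-! ### Deterministic bounds along a ray -/

/-- **Sup-norm of the perturbation, uniformly in the volume per site**: for a kernel admissible at radius `ε`,
`‖W_K(θ)‖ ≤ 432 ε L³` (`|j_b| ≤ 1`, row sums `Σ_{b'} ‖K(b,b')‖ ≤ 144 ε`, `3L³` directed bonds). -/
theorem cum_norm_Wk_le [NeZero L] {ε : ℝ} {K : Bond L → Bond L → ℂ} (hK : Admissible L ε K)
    (θ : TorusSite 3 L → ℝ) : ‖Wk K θ‖ ≤ 432 * ε * (L : ℝ) ^ 3 := by
  calc ‖Wk K θ‖ ≤ ∑ b : Bond L, ∑ b' : Bond L, ‖K b b'‖ := ent_norm_Wk_le K θ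
    _ ≤ ∑ _b : Bond L, 144 * ε := Finset.sum_le_sum fun b _ => row_sum_norm_le_of_admissible K hK b
    _ = 432 * ε * (L : ℝ) ^ 3 := by
        simp only [Finset.sum_const, Finset.card_univ, nsmul_eq_mul, Fintype.card_prod, Fintype.card_fin,
          Fintype.card_fun, ZMod.card]
        push_cast; ring

/-- The real unperturbed weight and its integral (`Z(0)` as a real number). -/
theorem cum_Zk_zero_eq [NeZero L] (J : ℝ) :
    Zk J (0 : Bond L → Bond L → ℂ) =
      ((∫ θ in cube L, Real.exp (J * ∑ b : Bond L, Real.cos (θ (b.1 + Pi.single b.2 1) - θ b.1)) : ℝ) : ℂ) :=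
  even_Zk_zero_eq J

/-- **A-priori growth along a ray**: `‖Z(t • K)‖ ≤ exp(‖t‖ · 432 ε L³) · Z(0)` for `K` admissible at radius `ε`
(`|e^{tW}| = e^{Re(tW)} ≤ e^{‖t‖ sup ‖W‖}` against the positive weight). -/
theorem cum_norm_Zk_smul_le [NeZero L] (J : ℝ) {ε : ℝ} {K : Bond L → Bond L → ℂ} (hK : Admissible L ε K)
    (t : ℂ) :
    ‖Zk J (t • K)‖ ≤ Real.exp (‖t‖ * (432 * ε * (L : ℝ) ^ 3)) *
      ∫ θ in cube L, Real.exp (J * ∑ b : Bond L, Real.cos (θ (b.1 + Pi.single b.2 1) - θ b.1)) := by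
  set S : ℝ := 432 * ε * (L : ℝ) ^ 3 with hS
  set w0 : (TorusSite 3 L → ℝ) → ℝ := fun θ =>
    Real.exp (J * ∑ b : Bond L, Real.cos (θ (b.1 + Pi.single b.2 1) - θ b.1)) with hw0
  have hw0c : Continuous w0 := continuous_xyWeight J
  have hw0i : IntegrableOn w0 (cube L) volume := hw0c.continuousOn.integrableOn_compact ent_isCompact_cube
  have hpt : ∀ θ, ‖wJ J θ * Complex.exp (Wk (t • K) θ)‖ ≤ Real.exp (‖t‖ * S) * w0 θ := by
    intro θ
    rw [norm_mul, Complex.norm_exp, ent_Wk_smul]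
    have h1 : ‖wJ J θ‖ = w0 θ := by
      unfold wJ; rw [Complex.norm_real, Real.norm_eq_abs, abs_of_pos (Real.exp_pos _)]
    rw [h1, mul_comm]
    refine mul_le_mul_of_nonneg_right (Real.exp_le_exp.2 ?_) (Real.exp_pos _).le
    calc (t * Wk K θ).re ≤ ‖t * Wk K θ‖ := Complex.re_le_norm _
      _ = ‖t‖ * ‖Wk K θ‖ := norm_mul _ _
      _ ≤ ‖t‖ * S := mul_le_mul_of_nonneg_left (cum_norm_Wk_le hK θ) (norm_nonneg _)
  unfold Zk
  calc ‖∫ θ in cube L, wJ J θ * Complex.exp (Wk (t • K) θ)‖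
      ≤ ∫ θ in cube L, Real.exp (‖t‖ * S) * w0 θ := by
        refine norm_integral_le_of_norm_le (hw0i.const_mul _) (ae_of_all _ fun θ => hpt θ)
    _ = Real.exp (‖t‖ * S) * ∫ θ in cube L, w0 θ := integral_const_mul _ _

/-! ### A holomorphic logarithm of `Z(tK)/Z(0)` on a zero-free disc -/

/-- **Holomorphic logarithm on a zero-free disc.** If `Z` is entire and zero-free on `ball 0 R`, there is `G` holomorphic on the
disc with `G 0 = 0` and `Z t = Z 0 · exp (G t)` there (primitive of `Z'/Z`, Mathlib `DifferentiableOn.isExactOn_ball`). [folklore] -/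
theorem cum_exists_log {Z : ℂ → ℂ} (hZ : Differentiable ℂ Z) {R : ℝ} (hR : 0 < R)
    (hzf : ∀ t ∈ ball (0 : ℂ) R, Z t ≠ 0) :
    ∃ G : ℂ → ℂ, G 0 = 0 ∧ DifferentiableOn ℂ G (ball 0 R) ∧ (∀ t ∈ ball (0 : ℂ) R, HasDerivAt G (deriv Z t / Z t) t) ∧
      ∀ t ∈ ball (0 : ℂ) R, Z t = Z 0 * Complex.exp (G t) := by
  have hZ' : Differentiable ℂ (deriv Z) := (hZ.contDiff (n := 2)).differentiable_deriv_two
  have hh : DifferentiableOn ℂ (fun t => deriv Z t / Z t) (ball 0 R) :=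
    (hZ'.differentiableOn).div hZ.differentiableOn hzf
  obtain ⟨G, hG0, hG⟩ := (hh.isExactOn_ball).with_val_at 0 0
  have hGd : DifferentiableOn ℂ G (ball 0 R) := fun t ht => (hG t ht).differentiableAt.differentiableWithinAt
  refine ⟨G, hG0, hGd, hG, ?_⟩
  -- `φ = Z e^{-G}` has zero derivative on the disc, hence is constant `= Z 0`
  set Φ : ℂ → ℂ := fun t => Z t * Complex.exp (-G t) with hΦ
  have hΦd : ∀ t ∈ ball (0 : ℂ) R, HasDerivAt Φ 0 t := by
    intro t ht
    have h1 : HasDerivAt Z (deriv Z t) t := (hZ t).hasDerivAt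
    have h2 : HasDerivAt (fun s => Complex.exp (-G s)) (Complex.exp (-G t) * (-(deriv Z t / Z t))) t :=
      (hG t ht).neg.cexp
    have hZt := hzf t ht
    refine (h1.mul h2).congr_deriv ?_
    have hc : Z t * (Complex.exp (-G t) * -(deriv Z t / Z t)) = -(deriv Z t * Complex.exp (-G t)) := by
      calc Z t * (Complex.exp (-G t) * -(deriv Z t / Z t))
          = -(Complex.exp (-G t) * (Z t * (deriv Z t / Z t))) := by ring
        _ = -(Complex.exp (-G t) * deriv Z t) := by rw [← mul_div_assoc, mul_div_cancel_left₀ _ hZt]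
        _ = -(deriv Z t * Complex.exp (-G t)) := by ring
    rw [hc]; ring
  have hΦD : DifferentiableOn ℂ Φ (ball 0 R) := fun t ht => (hΦd t ht).differentiableAt.differentiableWithinAt
  have hΦ' : (ball (0 : ℂ) R).EqOn (deriv Φ) 0 := fun t ht => (hΦd t ht).deriv
  intro t ht
  have hconst := isOpen_ball.is_const_of_deriv_eq_zero (convex_ball (0 : ℂ) R).isPreconnected hΦD hΦ' ht
    (mem_ball_self hR)
  simp only [hΦ, hG0, neg_zero, Complex.exp_zero, mul_one] at hconst
  -- `Z t e^{-G t} = Z 0`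
  calc Z t = Z t * Complex.exp (-G t) * Complex.exp (G t) := by
        rw [mul_assoc, ← Complex.exp_add, neg_add_cancel, Complex.exp_zero, mul_one]
    _ = Z 0 * Complex.exp (G t) := by rw [hconst]

/-! ### The converse -/

/-- **Gevrey-1 cumulant bounds from the crux** (converse of `perturbedXYOrder_of_cumulantBounds`). If `PerturbedXYOrder` holds with
`(J₀, ε, a)` then, with `ε₁ = ε/2` and an explicit `A = A(ε)`, for all `J ≥ J₀`, `L ≥ 2` and all kernels admissible at radius `ε₁`
the Taylor coefficients at `t = 0` of `t ↦ log(Z(tK)/Z(0))` are bounded by `n! Aⁿ L³` and those of `t ↦ cratio L J (t • K)` by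
`n! Aⁿ` (`n ≥ 1`). [folklore] -/
theorem cumulantBounds_of_perturbedXYOrder (h : PerturbedXYOrder) :
    ∃ J₀ ε₁ A : ℝ, 0 < ε₁ ∧ 0 < A ∧ ∀ J : ℝ, J₀ ≤ J → ∀ (L : ℕ) [NeZero L], 2 ≤ L →
      ∀ K : Bond L → Bond L → ℂ, Admissible L ε₁ K →
        (∀ n : ℕ, 1 ≤ n →
          ‖iteratedDeriv n (fun t : ℂ => Complex.log (Zk J (t • K) / Zk J (0 : Bond L → Bond L → ℂ))) 0‖ ≤
            (n.factorial : ℝ) * A ^ n * (L : ℝ) ^ 3) ∧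
        (∀ n : ℕ, 1 ≤ n → ‖iteratedDeriv n (fun t : ℂ => cratio L J (t • K)) 0‖ ≤ (n.factorial : ℝ) * A ^ n) := by
  rw [perturbedXYOrder_iff] at h
  obtain ⟨J₀, ε, a, hε, ha, h⟩ := h
  -- constants
  set A : ℝ := max 10 (4 / 3 * (2592 * ε + 6)) with hA
  have hA10 : (10 : ℝ) ≤ A := le_max_left _ _
  have hA2 : 4 / 3 * (2592 * ε + 6) ≤ A := le_max_right _ _
  have hApos : 0 < A := by positivity
  refine ⟨J₀, ε / 2, A, by positivity, hApos, ?_⟩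
  intro J hJ L _ hL K hK
  -- the crux along the ray `t • K`, `‖t‖ ≤ 2`
  have hray : ∀ t : ℂ, ‖t‖ ≤ 2 → Zk J (t • K) ≠ 0 ∧ a ≤ (cratio L J (t • K)).re := fun t ht =>
    h J hJ L hL (t • K) (sch_admissible_smul (by nlinarith [norm_nonneg t]) hK)
  obtain ⟨hZd, hNd⟩ := stub_entire J L K
  have hL1 : (1 : ℝ) ≤ (L : ℝ) ^ 3 := by
    have : (1 : ℝ) ≤ (L : ℝ) := by exact_mod_cast NeZero.one_le
    exact one_le_pow₀ this
  constructor
  · ----------------------------------------------------------------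
    -- FREE-ENERGY HALF
    ----------------------------------------------------------------
    intro n hn
    set Z : ℂ → ℂ := fun t => Zk J (t • K) with hZdef
    have hzf : ∀ t ∈ ball (0 : ℂ) 2, Z t ≠ 0 := fun t ht => (hray t (mem_ball_zero_iff.1 ht).le).1
    obtain ⟨G, hG0, hGd, hGder, hGexp⟩ := cum_exists_log hZd two_pos hzf
    have hZ0 : Z 0 = Zk J (0 : Bond L → Bond L → ℂ) := by simp [hZdef]
    have hZ0ne : Z 0 ≠ 0 := hzf 0 (mem_ball_self two_pos)
    -- the real `Z(0)` and the growth bound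
    set Z0r : ℝ := ∫ θ in cube L, Real.exp (J * ∑ b : Bond L, Real.cos (θ (b.1 + Pi.single b.2 1) - θ b.1))
      with hZ0r
    have hZ0r_pos : 0 < Z0r := integral_xyWeight_pos (L := L) J
    have hZ0eq : Z 0 = (Z0r : ℂ) := by rw [hZ0]; exact cum_Zk_zero_eq J
    set S : ℝ := 432 * (ε / 2) * (L : ℝ) ^ 3 with hS
    have hS0 : 0 ≤ S := by positivity
    have hgrowth : ∀ t : ℂ, ‖Z t / Z 0‖ ≤ Real.exp (‖t‖ * S) := by
      intro t
      rw [norm_div, div_le_iff₀ (norm_pos_iff.2 hZ0ne), hZ0eq, Complex.norm_real, Real.norm_eq_abs,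
        abs_of_pos hZ0r_pos]
      exact cum_norm_Zk_smul_le J hK t
    -- `Re G ≤ 2S < M` on the disc
    set M : ℝ := 2 * S + 1 with hM
    have hMpos : 0 < M := by positivity
    have hGre : MapsTo G (ball (0 : ℂ) 2) {z : ℂ | z.re ≤ M} := by
      intro t ht
      have ht2 : ‖t‖ < 2 := mem_ball_zero_iff.1 ht
      have hexp : Complex.exp (G t) = Z t / Z 0 := by
        rw [hGexp t ht, mul_div_cancel_left₀ _ hZ0ne]
      have hre : (G t).re = Real.log ‖Z t / Z 0‖ := by
        rw [← hexp, Complex.norm_exp, Real.log_exp]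
      simp only [mem_setOf_eq, hre]
      have hpos : 0 < ‖Z t / Z 0‖ := norm_pos_iff.2 (div_ne_zero (hzf t ht) hZ0ne)
      calc Real.log ‖Z t / Z 0‖ ≤ Real.log (Real.exp (‖t‖ * S)) := Real.log_le_log hpos (hgrowth t)
        _ = ‖t‖ * S := Real.log_exp _
        _ ≤ 2 * S := mul_le_mul_of_nonneg_right ht2.le hS0
        _ ≤ M := by linarith
    -- Borel–Carathéodory: `‖G‖ ≤ 6M` on the disc of radius `3/2`
    have hGbd : ∀ t ∈ ball (0 : ℂ) (3 / 2), ‖G t‖ ≤ 6 * M := by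
      intro t ht
      have ht' : ‖t‖ < 3 / 2 := mem_ball_zero_iff.1 ht
      have ht2 : t ∈ ball (0 : ℂ) 2 := mem_ball_zero_iff.2 (by linarith)
      have hBC := Complex.borelCaratheodory_zero hMpos hGd hGre two_pos ht2 hG0
      refine hBC.trans ?_
      rw [div_le_iff₀ (by linarith)]
      nlinarith [norm_nonneg t]
    -- Cauchy's estimate on the disc of radius `3/2`
    have hCauchy := Literature.Analysis.Complex.norm_iteratedDeriv_le_of_forall_mem_ball (f := G) (c := 0)
      (by norm_num : (0 : ℝ) < 3 / 2) (hGd.mono (ball_subset_ball (by norm_num))) hGbd n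
    -- `log(Z(tK)/Z(0)) = G` near `t = 0`
    have hGc : ContinuousAt G 0 := (hGder 0 (mem_ball_self two_pos)).continuousAt
    have hev : (fun t : ℂ => Complex.log (Zk J (t • K) / Zk J (0 : Bond L → Bond L → ℂ))) =ᶠ[𝓝 0] G := by
      have h1 : ∀ᶠ t in 𝓝 (0 : ℂ), ‖G t‖ < Real.pi := by
        have := hGc.norm.tendsto
        rw [hG0, norm_zero] at this
        exact this.eventually (gt_mem_nhds Real.pi_pos)
      have h2 : ∀ᶠ t in 𝓝 (0 : ℂ), t ∈ ball (0 : ℂ) 2 := isOpen_ball.mem_nhds (mem_ball_self two_pos)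
      filter_upwards [h1, h2] with t ht1 ht2
      have hexp : Zk J (t • K) / Zk J (0 : Bond L → Bond L → ℂ) = Complex.exp (G t) := by
        rw [← hZ0]
        show Z t / Z 0 = Complex.exp (G t)
        rw [hGexp t ht2, mul_div_cancel_left₀ _ hZ0ne]
      rw [hexp]
      have him : |(G t).im| < Real.pi := (Complex.abs_im_le_norm _).trans_lt ht1
      exact Complex.log_exp (by linarith [(abs_lt.1 him).1]) (abs_lt.1 him).2.le
    rw [hev.iteratedDeriv_eq n]
    refine hCauchy.trans ?_
    -- arithmetic: `n! · 6M / (3/4)ⁿ ≤ n! · Aⁿ · L³`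
    have h34 : (3 / 2 / 2 : ℝ) = 3 / 4 := by norm_num
    rw [h34, div_eq_mul_inv, ← inv_pow, show ((3 / 4 : ℝ))⁻¹ = 4 / 3 by norm_num]
    have h6M : 6 * M ≤ (2592 * ε + 6) * (L : ℝ) ^ 3 := by
      rw [hM, hS]; nlinarith [hε]
    have hpow : (2592 * ε + 6) * (4 / 3 : ℝ) ^ n ≤ A ^ n := by
      have hc1 : (1 : ℝ) ≤ 2592 * ε + 6 := by nlinarith
      calc (2592 * ε + 6) * (4 / 3 : ℝ) ^ n ≤ (2592 * ε + 6) ^ n * (4 / 3 : ℝ) ^ n := by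
            refine mul_le_mul_of_nonneg_right ?_ (by positivity)
            exact le_self_pow₀ hc1 (by omega)
        _ = (4 / 3 * (2592 * ε + 6)) ^ n := by rw [← mul_pow]; ring
        _ ≤ A ^ n := pow_le_pow_left₀ (by positivity) hA2 n
    calc (n ! : ℝ) * (6 * M) * (4 / 3 : ℝ) ^ n ≤ (n ! : ℝ) * ((2592 * ε + 6) * (L : ℝ) ^ 3) * (4 / 3 : ℝ) ^ n := by
          gcongr
      _ = (n ! : ℝ) * ((2592 * ε + 6) * (4 / 3 : ℝ) ^ n) * (L : ℝ) ^ 3 := by ring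
      _ ≤ (n ! : ℝ) * A ^ n * (L : ℝ) ^ 3 := by gcongr
  · ----------------------------------------------------------------
    -- PLATEAU HALF
    ----------------------------------------------------------------
    intro n hn
    set f : ℂ → ℂ := fun t => cratio L J (t • K) with hf
    have hfd2 : DifferentiableOn ℂ f (ball 0 2) := by
      intro t ht
      have ht' : ‖t‖ ≤ 2 := (mem_ball_zero_iff.1 ht).le
      have : DifferentiableAt ℂ f t := by
        simp only [hf]; unfold cratio
        exact ((hNd t).div (hZd t) (hray t ht').1).div_const _
      exact this.differentiableWithinAt
    have hmaps : MapsTo (fun t => -f t) (ball (0 : ℂ) 2) {z : ℂ | z.re ≤ 1} := by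
      intro t ht
      have := (hray t (mem_ball_zero_iff.1 ht).le).2
      simp only [mem_setOf_eq, hf, Complex.neg_re]
      linarith
    have hf0 : ‖f 0‖ ≤ 1 := by simp only [hf, zero_smul]; exact norm_cratio_zero_le_one J
    have hfbd : ∀ t ∈ ball (0 : ℂ) 1, ‖f t‖ ≤ 5 := by
      intro t ht
      have ht1 : ‖t‖ < 1 := mem_ball_zero_iff.1 ht
      have ht2 : t ∈ ball (0 : ℂ) 2 := mem_ball_zero_iff.2 (by linarith)
      have hBC := Complex.borelCaratheodory (f := fun t => -f t) one_pos hfd2.neg hmaps two_pos ht2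
      rw [norm_neg, norm_neg] at hBC
      refine hBC.trans ?_
      have hden : 0 < 2 - ‖t‖ := by linarith
      rw [← add_div, div_le_iff₀ hden]
      nlinarith [norm_nonneg t, norm_nonneg (f 0)]
    have hCauchy := Literature.Analysis.Complex.norm_iteratedDeriv_le_of_forall_mem_ball (f := f) (c := 0) one_pos
      (hfd2.mono (ball_subset_ball (by norm_num))) hfbd n
    refine hCauchy.trans ?_
    rw [div_eq_mul_inv, ← inv_pow, show ((1 / 2 : ℝ))⁻¹ = 2 by norm_num]
    have hpow : 5 * (2 : ℝ) ^ n ≤ A ^ n := by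
      calc 5 * (2 : ℝ) ^ n ≤ 5 ^ n * (2 : ℝ) ^ n := by
            refine mul_le_mul_of_nonneg_right (le_self_pow₀ (by norm_num) (by omega)) (by positivity)
        _ = 10 ^ n := by rw [← mul_pow]; norm_num
        _ ≤ A ^ n := pow_le_pow_left₀ (by norm_num) hA10 n
    calc (n ! : ℝ) * 5 * (2 : ℝ) ^ n = (n ! : ℝ) * (5 * (2 : ℝ) ^ n) := by ring
      _ ≤ (n ! : ℝ) * A ^ n := by gcongr

/-- **The crux is equivalent to the Gevrey-1 cumulant bounds.** `PerturbedXYOrder` holds iff there are `J₀`, `ε₁ > 0`, `A > 0`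
such that for `J ≥ J₀`, `L ≥ 2` and all kernels admissible at radius `ε₁` the Taylor coefficients at `0` of `log(Z(tK)/Z(0))` are
`≤ n! Aⁿ L³` and those of `cratio L J (t • K)` are `≤ n! Aⁿ` (`n ≥ 1`) — verbatim the registered stub `stub_cumulantBounds`
(⇐: `perturbedXYOrder_of_cumulantBounds`, line `schwarz-inheritance`; ⇒: `cumulantBounds_of_perturbedXYOrder`). -/
theorem perturbedXYOrder_iff_cumulantBounds :
    PerturbedXYOrder ↔
      ∃ J₀ ε₁ A : ℝ, 0 < ε₁ ∧ 0 < A ∧ ∀ J : ℝ, J₀ ≤ J → ∀ (L : ℕ) [NeZero L], 2 ≤ L →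
        ∀ K : Bond L → Bond L → ℂ, Admissible L ε₁ K →
          (∀ n : ℕ, 1 ≤ n →
            ‖iteratedDeriv n (fun t : ℂ => Complex.log (Zk J (t • K) / Zk J (0 : Bond L → Bond L → ℂ))) 0‖ ≤
              (n.factorial : ℝ) * A ^ n * (L : ℝ) ^ 3) ∧
          (∀ n : ℕ, 1 ≤ n → ‖iteratedDeriv n (fun t : ℂ => cratio L J (t • K)) 0‖ ≤ (n.factorial : ℝ) * A ^ n) :=
  ⟨cumulantBounds_of_perturbedXYOrder, perturbedXYOrder_of_cumulantBounds⟩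

end Summit.HubbardSuperconductivity.HubbardSuperconductivity.Theorems.PerturbedXYOrder

end
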